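import Summits.ResolutionOfSingularities.ResolutionOfSingularities.Theorems.EquisingularLiftEquisingularLiftNatCechShadowOldLocal
import Summits.ResolutionOfSingularities.ResolutionOfSingularities.Theorems.EquisingularLiftEquisingularLiftNatTowerCurveStep
import Literature.AlgebraicGeometry.Resolution.EtaleVanishingIdeal
import Mathlib.RingTheory.RegularLocalRing.Defs
import HarnessLib

/-!
# [OURS · L1 W4.5(b) · EL♮(3)] (N3′) DISCHARGED — `Tower.hShadowOld_of`: THE TRANSPORTED OLD EXCEPTIONAL SURFACE AGAINST THE TRANSPORTED SHADOW
# AFTER A ČECH ROUND OFF THE SHADOW (the `hShadowOld` binder of res-L1-w45b-stub-4's `Tower.hCech₃_of_lift_sec_kiv`, (k-iv) re-cut, VERBATIM as conclusion)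

Crux chain w45b (cell `res-hironaka`, slot W4.5(b)), working crux **EL♮** = stmt-ResolutionOfSingularities-20038, child **EL♮(3)** =
stmt-ResolutionOfSingularities-20148, route EquisingularLift, line `sections`; registered stub `stub_elnat_coneTowerPointResolution` @ `ReachTower₄`
(v7 assembly `hsub_reachTower_four_of_kcl` p576510), S6 closer of record `Tower.hCech₃_of_lift_sec_kiv … hLift hShadow hShadowOld …` (p579344),
plug `stub_elnat_coneTowerPointResolution_three_of_liftShadow` (p579941, sockets `hN3` / `hN3'`). THIS FILE supplies `hShadowOld` = `hN3'`
(sub-stand-in (N3′), (k-iv) re-cut after this seat's finding 2026-08-27T21:54:54Z that the un-cut (N3′) is not derivable); the companion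
…NatCechShadowNew (p581085) supplies `hShadow` = `hN3`. Written by res-L1-w45b-stub-2 g8. HONEST FRAMING: OURS; NOT a statement of any manuscript;
AI-written, weaker than expert review. No `sorry`; standard axioms; DEF-FREE. `--supports stmt-ResolutionOfSingularities-20148 --as helper`.

WHAT. `Tower.hShadowOld_of O k θ hθ P q hqprop Y hYirr hYcl hPnoeth hPreg Ch hChain hPint` (`SmoothOfRelativeDimension 3 q` an instance argument) has as
its TYPE the `hShadowOld` binder of `Tower.hCech₃_of_lift_sec_kiv` VERBATIM: for a Čech round `τ = Bl_𝒞`, `𝒞 = 𝓔 ⊔ 𝒦₁`, off the shadow, GIVEN the old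
(k-iv) for `(𝓔, 𝒦)`, the five clauses (k-ii-loc)′, (k-iii)′, (k-iv)′, (k-v)′, (k-vi)′ of `Tower.Shadow₃` for the OLD pair transported:
`(St_𝒞 𝓔, St_𝒞 𝒦)`. UNIFORM in `Z ∩ closure K`.
HOW. The old exceptional surface does not move: `ρ : V(St_𝒞 𝓔) ≅ V(𝓔)` over `τ` (res-D-pv-051 `exists_iso_subscheme_strictTransformIdeal_exceptional`),
so at `y₂ ∈ V(St_𝒞 𝓔)`, `x = τ y₂`, the map `τ♯` induces `𝒪_{X,x}/(𝓔_x + 𝔟) ≅ 𝒪_{X₂,y₂}/((St 𝓔)_{y₂} + 𝔟·𝒪)` for every ideal `𝔟` (…NatCechShadowOldIso).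
With `(St 𝒦)_{y₂} = (τ♯ f)` at the special points (`𝒦_x = (f)`; …NatCechShadowLocal (a) over the centre, `stalkIdeal_strictTransformIdeal_of_not_mem`
off it): (k-ii-loc)′ is clause (1) of (N3) (`Tower.hShadow_of`); (k-iii)′ is `ϖ`-torsion-freeness of `𝒪/(𝓔 + 𝒦)_x` ((k-iii),
`mem_stalkIdeal_of_varpi_mul_mem_of_flat`) moved through `τ♯`; (k-iv)′: the radical trace hypothesis upstairs descends through `j₂♯`, `τ♯` and `j_G♯` to
the old (k-iv) hypothesis at `p = υ₂ y` (`stalkIdeal_sup_vanishingIdeal_eq_inter_of_isReduced`), the old (k-iv) gives `𝒪_{X,x}/(𝓔 + 𝒦)_x` regular, and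
the quotient isomorphism moves it up; (k-v)′ pointwise (`isEffectiveCartier_of_forall_mem_nonZeroDivisors`): `(St 𝓔)_{y₂}` is prime (`V(St 𝓔) ≅ V(𝓔)`
regular) and does not contain the generator of `(St 𝒦)_{y₂}` (else `f ∈ 𝓔_x`, against (k-vi)), then the domain swap `mul_mem_span_singleton_swap`;
(k-vi)′ = `isEffectiveCartier_comap_subschemeι_swap`.

References (index only): [cite: GortzWedhorn2020, (13.19) and Prop. 13.91]; [cite: Liu2002, Thm. 8.1.19]; [cite: StacksProject, Tag 0BIQ]; [cite: Matsumura1987,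
Thm. 14.2]. Tree inputs as named above and in the module docstrings of …NatCechShadow{ChartAlgebra,Ring,Trace,Local,Package,New,OldIso}.
-/

set_option linter.dupNamespace false -- mandated namespace `Summit.<Summit>.<Problem>` of this single-conjunct summit
set_option linter.overlappingInstances false -- signatures carry `[IsDomain O] [IsDiscreteValuationRing O]`

noncomputable section

open CategoryTheory CategoryTheory.Limits AlgebraicGeometry TopologicalSpace Topology IsLocalRing
open Literature.AlgebraicGeometry.Resolution
open Literature.AlgebraicGeometry.Morphisms (ProjCech.PP ProjCech.toSpec)
open AlgebraicGeometry.Scheme.IdealSheafData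
open Summit.ResolutionOfSingularities.ResolutionOfSingularities.Theses.EquisingularLift.Split
open Summit.ResolutionOfSingularities.ResolutionOfSingularities.Cruxes.EquisingularLift.StrataSplit

namespace Summit.ResolutionOfSingularities.ResolutionOfSingularities.Cruxes.EquisingularLiftNat.Sections


open CechShadow

set_option maxHeartbeats 1600000 in -- long binder text; five clauses with per-point packages
/-- **(N3′) `hShadowOld` of `Tower.hCech₃_of_lift_sec_kiv`, DISCHARGED** (see the module docstring; the conclusion is the binder VERBATIM).
[cite: GortzWedhorn2020, (13.19) and Prop. 13.91] [cite: Liu2002, Thm. 8.1.19] [cite: StacksProject, Tag 0BIQ] [OURS · L1 W4.5b] S6 of TOWER₄ toward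
`stub_elnat_coneTowerPointResolution` (stmt-ResolutionOfSingularities-20148 / -20038); NOT a statement of the manuscript. -/
theorem Tower.hShadowOld_of (O : Type) [CommRing O] [IsDomain O] [IsDiscreteValuationRing O] (k : Type) [Field k]
    (θ : O →+* k) (hθ : Function.Surjective θ)
    (P : Scheme.{0}) (q : P ⟶ Spec (.of O)) (hqprop : IsProper q) (Y : Set P) (hYirr : IsIrreducible Y) (hYcl : IsClosed Y)
    (hPnoeth : IsLocallyNoetherian P) (hPreg : Scheme.IsRegular P)
    (Ch : ∀ X' : Scheme.{0}, (X' ⟶ P) → Set X' → Prop)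
    (hChain : ∀ (X' : Scheme.{0}) (σ : X' ⟶ P) (S : Set X'), Ch X' σ S → Chain P Y X' σ S)
    (hPint : IsIntegral P) [SmoothOfRelativeDimension 3 q] :
    ∀ {F₉ : Scheme.{0}} (Z₉ : Set F₉) (hZ₉ : IsClosed Z₉) {F₁₀ : Scheme.{0}} (υ' : F₁₀ ⟶ F₉)
        (G G' : Scheme.{0}) (γ : G ⟶ F₁₀) (T E K : Set G) (hE : IsClosed E) (Z : Set G) (hZ : IsClosed Z) (υ₂ : G' ⟶ G),
        DirStepSec F₉ F₁₀ υ' Z₉ hZ₉ G γ Z hZ → IsBlowup υ₂ (vanishingIdeal ⟨Z, hZ⟩) →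
        ∀ (X : Scheme.{0}) (σ : X ⟶ P) (S : Set X) (jG : G ⟶ X) (tG : G ⟶ Spec (.of k)) (𝓔 𝒦 𝒦₁ : X.IdealSheafData)
        (X₂ : Scheme.{0}) (τ : X₂ ⟶ X) (j₂ : G' ⟶ X₂) (t₂ : G' ⟶ Spec (.of k)),
        Ch X σ S → IsIntegral X → IsLocallyNoetherian X → Scheme.IsRegular X → IsDominant (σ ≫ q) →
        IsPullback jG tG (σ ≫ q) (Spec.map (CommRingCat.ofHom θ)) → jG '' T = S →
        𝓔.comap jG = vanishingIdeal ⟨E, hE⟩ → (∀ z : X, (stalkIdeal 𝓔 z).IsPrincipal) → Scheme.IsRegular 𝓔.subscheme →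
        (∀ z : X, (stalkIdeal 𝒦 z).IsPrincipal) → ∀ (V : G.Opens), E ⊆ (V : Set G) →
        (𝒦.comap jG).comap V.ι = (vanishingIdeal (⟨closure K, isClosed_closure⟩ : Closeds G)).comap V.ι →
        Flat ((𝓔 ⊔ 𝒦).subschemeι ≫ σ ≫ q) →
        (∀ y : G, jG y ∈ ((𝓔 ⊔ 𝒦).support : Set X) →
          stalkIdeal (vanishingIdeal (⟨E, hE⟩ : Closeds G) ⊔ vanishingIdeal (⟨closure K, isClosed_closure⟩ : Closeds G)) y =
            stalkIdeal (vanishingIdeal (⟨E ∩ closure K, hE.inter isClosed_closure⟩ : Closeds G)) y →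
          IsRegularLocalRing (X.presheaf.stalk (jG y) ⧸ stalkIdeal (𝓔 ⊔ 𝒦) (jG y))) →
        IsEffectiveCartier (𝓔.comap 𝒦.subschemeι) → IsEffectiveCartier (𝒦.comap 𝓔.subschemeι) →
        (𝓔 ⊔ 𝒦₁).comap jG = vanishingIdeal ⟨Z, hZ⟩ → Flat ((𝓔 ⊔ 𝒦₁).subschemeι ≫ σ ≫ q) → Scheme.IsRegular (𝓔 ⊔ 𝒦₁).subscheme →
        IsEffectiveCartier (𝒦₁.comap 𝓔.subschemeι) →
        IsBlowup τ (𝓔 ⊔ 𝒦₁) → IsPullback j₂ t₂ ((τ ≫ σ) ≫ q) (Spec.map (CommRingCat.ofHom θ)) → j₂ ≫ τ = υ₂ ≫ jG →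
        IsClosed K → K ⊆ closure (K \ E) → K ≠ Set.univ → closure (Z \ closure K) = Z →
        ((strictTransformIdeal τ (𝓔 ⊔ 𝒦₁) 𝒦).comap j₂).comap (υ₂ ⁻¹ᵁ V).ι =
            (vanishingIdeal (⟨closure (closure (υ₂ ⁻¹' (K \ Z))), isClosed_closure⟩ : Closeds G')).comap (υ₂ ⁻¹ᵁ V).ι ∧
          Flat ((strictTransformIdeal τ (𝓔 ⊔ 𝒦₁) 𝓔 ⊔ strictTransformIdeal τ (𝓔 ⊔ 𝒦₁) 𝒦).subschemeι ≫ (τ ≫ σ) ≫ q) ∧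
          (∀ (hE' : IsClosed (closure (υ₂ ⁻¹' (E \ Z)))) (y : G'),
            j₂ y ∈ ((strictTransformIdeal τ (𝓔 ⊔ 𝒦₁) 𝓔 ⊔ strictTransformIdeal τ (𝓔 ⊔ 𝒦₁) 𝒦).support : Set X₂) →
            stalkIdeal (vanishingIdeal (⟨closure (υ₂ ⁻¹' (E \ Z)), hE'⟩ : Closeds G') ⊔
              vanishingIdeal (⟨closure (closure (υ₂ ⁻¹' (K \ Z))), isClosed_closure⟩ : Closeds G')) y =
            stalkIdeal (vanishingIdeal (⟨closure (υ₂ ⁻¹' (E \ Z)) ∩ closure (closure (υ₂ ⁻¹' (K \ Z))), hE'.inter isClosed_closure⟩ :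
              Closeds G')) y →
            IsRegularLocalRing (X₂.presheaf.stalk (j₂ y) ⧸
              stalkIdeal (strictTransformIdeal τ (𝓔 ⊔ 𝒦₁) 𝓔 ⊔ strictTransformIdeal τ (𝓔 ⊔ 𝒦₁) 𝒦) (j₂ y))) ∧
          IsEffectiveCartier ((strictTransformIdeal τ (𝓔 ⊔ 𝒦₁) 𝓔).comap (strictTransformIdeal τ (𝓔 ⊔ 𝒦₁) 𝒦).subschemeι) ∧
          IsEffectiveCartier ((strictTransformIdeal τ (𝓔 ⊔ 𝒦₁) 𝒦).comap (strictTransformIdeal τ (𝓔 ⊔ 𝒦₁) 𝓔).subschemeι) := by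
  intro F₉ Z₉ hZ₉ F₁₀ υ' G G' γ T E K hE Z hZ υ₂ hsec hυ₂ X σ S jG tG 𝓔 𝒦 𝒦₁ X₂ τ j₂ t₂ hCh hXint hXnoeth hXreg hdom hsq hTS he_i he_ii
    he_iii hk_i V hEV hk_ii hk_iii hk_iv hk_v hk_vi hc1 hc2 hc3 hc4 hτ hsq₂ hcomm hKcl hKE hKne hoff
  classical
  -- clause (1) is clause (1) of (N3) for the same data
  obtain ⟨C1, -, -, -, -⟩ := Tower.hShadow_of O k θ hθ P q hqprop Y hYirr hYcl hPnoeth hPreg Ch hChain hPint Z₉ hZ₉ υ' G G' γ T E K hE Z hZ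
    υ₂ hsec hυ₂ X σ S jG tG 𝓔 𝒦 𝒦₁ X₂ τ j₂ t₂ hCh hXint hXnoeth hXreg hdom hsq hTS he_i he_ii he_iii hk_i V hEV hk_ii hk_iii hk_v hk_vi hc1
    hc2 hc3 hc4 hτ hsq₂ hcomm hKcl hKE hKne hoff
  haveI := hqprop
  haveI := hXint
  haveI := hXnoeth
  haveI := hPint
  obtain ⟨-, -, hσ⟩ := chain_isRegular P Y X σ S (hChain _ _ _ hCh) hPnoeth hPreg
  haveI := hσ
  haveI : IsProper (σ ≫ q) := inferInstance
  haveI : IsClosedImmersion (Spec.map (CommRingCat.ofHom θ)) := IsClosedImmersion.spec_of_surjective _ hθ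
  haveI hjci : IsClosedImmersion jG := MorphismProperty.IsStableUnderBaseChange.of_isPullback hsq.flip inferInstance
  have hsq₂' : IsPullback j₂ t₂ (τ ≫ σ ≫ q) (Spec.map (CommRingCat.ofHom θ)) := by simpa only [Category.assoc] using hsq₂
  haveI hj₂ci : IsClosedImmersion j₂ := MorphismProperty.IsStableUnderBaseChange.of_isPullback hsq₂'.flip inferInstance
  haveI : IsProper τ := hτ.isProper
  haveI hX₂noeth : IsLocallyNoetherian X₂ := LocallyOfFiniteType.isLocallyNoetherian τ
  haveI : IsLocallyNoetherian G := LocallyOfFiniteType.isLocallyNoetherian jG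
  haveI : IsLocallyNoetherian G' := LocallyOfFiniteType.isLocallyNoetherian j₂
  haveI : IsProper tG := MorphismProperty.IsStableUnderBaseChange.of_isPullback hsq inferInstance
  haveI : CompactSpace G := QuasiCompact.compactSpace_of_compactSpace tG
  haveI : IsNoetherian G := ⟨⟩
  obtain ⟨ϖ, hϖ⟩ := IsDiscreteValuationRing.exists_irreducible O
  -- the centre is non-zero; the blow-up is integral
  have hCne : 𝓔 ⊔ 𝒦₁ ≠ ⊥ := by
    intro hbot
    have hE0 : 𝓔 = ⊥ := le_bot_iff.mp (hbot ▸ le_sup_left)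
    have hK₁0 : 𝒦₁ = ⊥ := le_bot_iff.mp (hbot ▸ le_sup_right)
    obtain ⟨x₀⟩ := (inferInstance : Nonempty X)
    have hx₀ : x₀ ∈ (𝓔.support : Set X) := by rw [hE0, Scheme.IdealSheafData.support_bot]; trivial
    obtain ⟨xe, -⟩ : x₀ ∈ Set.range 𝓔.subschemeι := by rw [Scheme.IdealSheafData.range_subschemeι]; exact hx₀
    obtain ⟨t, ht, hKt⟩ := hc4.exists_stalkIdeal_eq_span xe
    rw [hK₁0, Scheme.IdealSheafData.comap_bot, stalkIdeal_bot, eq_comm, Ideal.span_singleton_eq_bot] at hKt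
    rw [hKt] at ht
    exact zero_notMem_nonZeroDivisors ht
  haveI : IsIntegral X₂ := hτ.isIntegral hCne
  -- the old exceptional surface does not move: `V(St 𝓔) ≅ V(𝓔)` over `τ`
  obtain ⟨e𝓔, he𝓔⟩ := exists_iso_subscheme_strictTransformIdeal_exceptional 𝓔 𝒦₁ hc4 hτ
  have hcart : IsPullback j₂ υ₂ τ jG := isPullback_of_model_squares θ hθ (σ ≫ q) τ jG tG hsq j₂ t₂ hsq₂' υ₂ hcomm
  have hEZ : E ⊆ closure (E \ Z) := subset_closure_diff_of_flat_of_isEffectiveCartier θ hθ q σ jG tG hsq 𝓔 𝒦₁ hE hZ he_i hc1 hc2 hc4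
  have ho1 : (strictTransformIdeal τ (𝓔 ⊔ 𝒦₁) 𝓔).comap j₂ = vanishingIdeal (⟨closure (υ₂ ⁻¹' (E \ Z)), isClosed_closure⟩ : Closeds G') :=
    coneRound_exceptional_comap 𝓔 𝒦₁ hc4 hτ hcart ⟨E, hE⟩ ⟨Z, hZ⟩ he_i hυ₂ hEZ
  -- support bookkeeping
  have hsuppZ : ((((𝓔 ⊔ 𝒦₁).comap jG)).support : Set G) = Z := by rw [hc1, Scheme.IdealSheafData.coe_support_vanishingIdeal]; rfl
  have hsuppE : ((𝓔.comap jG).support : Set G) = E := by rw [he_i, Scheme.IdealSheafData.coe_support_vanishingIdeal]; rfl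
  have hZE : Z ⊆ E := by
    rw [← hsuppZ, ← hsuppE]
    exact Scheme.IdealSheafData.support_antitone (Scheme.IdealSheafData.comap_mono jG (le_sup_left : 𝓔 ≤ 𝓔 ⊔ 𝒦₁))
  have hZV : ∀ p ∈ Z, p ∈ (V : Set G) := fun p hp => hEV (hZE hp)
  have hoff' : Z ⊆ closure (Z \ closure K) := by rw [hoff]
  have hKZ : ∀ p ∈ Z, stalkIdeal (𝒦.comap jG) p = stalkIdeal (vanishingIdeal (⟨closure K, isClosed_closure⟩ : Closeds G)) p :=
    fun p hp => stalkIdeal_eq_of_comap_ι_eq hk_ii (hZV p hp)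
  have hpt : ∀ y : G', τ (j₂ y) = jG (υ₂ y) := fun y => by
    rw [← Scheme.Hom.comp_apply, hcomm, Scheme.Hom.comp_apply]
  have hZiff : ∀ y : G', υ₂ y ∈ Z ↔ τ (j₂ y) ∈ ((𝓔 ⊔ 𝒦₁).support : Set X) := fun y => by
    rw [hpt, ← hsuppZ, Scheme.IdealSheafData.support_comap]; rfl
  have hZiff' : ∀ y : G', υ₂ y ∈ Z ↔ j₂ y ∈ ((((𝓔 ⊔ 𝒦₁).comap τ)).support : Set X₂) := fun y => by
    rw [hZiff, Scheme.IdealSheafData.support_comap]; rfl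
  have hEiff : ∀ y : G', υ₂ y ∈ E ↔ τ (j₂ y) ∈ (𝓔.support : Set X) := fun y => by
    rw [hpt, ← hsuppE, Scheme.IdealSheafData.support_comap]; rfl
  have hsuppStE : ∀ y₂ : X₂, y₂ ∈ ((strictTransformIdeal τ (𝓔 ⊔ 𝒦₁) 𝓔).support : Set X₂) → τ y₂ ∈ (𝓔.support : Set X) := by
    intro y₂ h
    have h' := Scheme.IdealSheafData.support_antitone (comap_le_strictTransformIdeal τ (𝓔 ⊔ 𝒦₁) 𝓔) h
    rw [Scheme.IdealSheafData.support_comap] at h'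
    exact h'
  have hsuppStK : ∀ y₂ : X₂, y₂ ∈ ((strictTransformIdeal τ (𝓔 ⊔ 𝒦₁) 𝒦).support : Set X₂) → τ y₂ ∈ (𝒦.support : Set X) := by
    intro y₂ h
    have h' := Scheme.IdealSheafData.support_antitone (comap_le_strictTransformIdeal τ (𝓔 ⊔ 𝒦₁) 𝒦) h
    rw [Scheme.IdealSheafData.support_comap] at h'
    exact h'
  -- germs of the uniformiser along `τ`
  have hgermτ : ∀ x' : X₂, (τ.stalkMap x').hom ((X.presheaf.Γgerm (τ x')).hom ((σ ≫ q).appTop.hom ((Scheme.ΓSpecIso (.of O)).inv.hom ϖ))) =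
      (X₂.presheaf.Γgerm x').hom (((τ ≫ σ) ≫ q).appTop.hom ((Scheme.ΓSpecIso (.of O)).inv.hom ϖ)) := by
    intro x'
    rw [Category.assoc, Scheme.Hom.comp_appTop τ (σ ≫ q)]
    exact Scheme.Hom.germ_stalkMap_apply τ ⊤ x' trivial _
  have hker₂ : ∀ y : G', RingHom.ker (j₂.stalkMap y).hom ≤
      Ideal.span {(τ.stalkMap (j₂ y)).hom ((X.presheaf.Γgerm (τ (j₂ y))).hom ((σ ≫ q).appTop.hom ((Scheme.ΓSpecIso (.of O)).inv.hom ϖ)))} :=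
    fun y => by rw [hgermτ]; exact ker_stalkMap_model_le O k θ hθ ((τ ≫ σ) ≫ q) j₂ t₂ hsq₂ y ϖ hϖ
  have hϖ₂0 : ∀ y : G', (j₂.stalkMap y).hom
      ((τ.stalkMap (j₂ y)).hom ((X.presheaf.Γgerm (τ (j₂ y))).hom ((σ ≫ q).appTop.hom ((Scheme.ΓSpecIso (.of O)).inv.hom ϖ)))) = 0 :=
    fun y => by rw [hgermτ]; exact stalkMap_model_varpi θ hθ ((τ ≫ σ) ≫ q) j₂ t₂ hsq₂ y ϖ (hϖ.maximalIdeal_eq ▸ Ideal.mem_span_singleton_self ϖ)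
  -- the package at the points over `Z`, at the literal point `τ (j₂ y)`
  have hpkg : ∀ y : G', υ₂ y ∈ Z → ∃ f : X.presheaf.stalk (τ (j₂ y)), stalkIdeal 𝒦 (τ (j₂ y)) = Ideal.span {f} ∧
      (∀ a, f * a ∈ stalkIdeal (𝓔 ⊔ 𝒦₁) (τ (j₂ y)) ⊔
          Ideal.span {(X.presheaf.Γgerm (τ (j₂ y))).hom ((σ ≫ q).appTop.hom ((Scheme.ΓSpecIso (.of O)).inv.hom ϖ))} →
        a ∈ stalkIdeal (𝓔 ⊔ 𝒦₁) (τ (j₂ y)) ⊔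
          Ideal.span {(X.presheaf.Γgerm (τ (j₂ y))).hom ((σ ≫ q).appTop.hom ((Scheme.ΓSpecIso (.of O)).inv.hom ϖ))}) ∧
      (∀ a, (X.presheaf.Γgerm (τ (j₂ y))).hom ((σ ≫ q).appTop.hom ((Scheme.ΓSpecIso (.of O)).inv.hom ϖ)) * a ∈
          stalkIdeal (𝓔 ⊔ 𝒦₁) (τ (j₂ y)) → a ∈ stalkIdeal (𝓔 ⊔ 𝒦₁) (τ (j₂ y))) ∧
      stalkIdeal (𝓔 ⊔ 𝒦₁) (τ (j₂ y)) ⊔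
          Ideal.span {(X.presheaf.Γgerm (τ (j₂ y))).hom ((σ ≫ q).appTop.hom ((Scheme.ΓSpecIso (.of O)).inv.hom ϖ))} ≠ ⊤ := by
    intro y hp
    have h := exists_cechShadow_package O k θ hθ (σ ≫ q) jG tG hsq ϖ hϖ (𝓔 ⊔ 𝒦₁) 𝒦 hc2 Z (closure K) hZ isClosed_closure hc1 hk_i hKZ hoff'
      (υ₂ y) hp
    rw [← hpt y] at h
    exact h
  -- the transported shadow is `(τ♯ f)` at every point of the new special fibre, `𝒦_x = (f)`
  have hgenK : ∀ y : G', ∃ f : X.presheaf.stalk (τ (j₂ y)), stalkIdeal 𝒦 (τ (j₂ y)) = Ideal.span {f} ∧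
      stalkIdeal (strictTransformIdeal τ (𝓔 ⊔ 𝒦₁) 𝒦) (j₂ y) = Ideal.span {(τ.stalkMap (j₂ y)).hom f} := by
    intro y
    by_cases hpZ : υ₂ y ∈ Z
    · obtain ⟨f, hf, hG1, hϖreg, hne⟩ := hpkg y hpZ
      obtain ⟨w, -, hSt, -, -, -⟩ := exists_generator_cechShadow_local hXreg hc3 hτ 𝒦 (j₂ y) ((hZiff y).mp hpZ) f _ hf hG1 hϖreg hne
      exact ⟨f, hf, hSt⟩
    · obtain ⟨f, hf⟩ := (hk_i (τ (j₂ y))).principal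
      have hf' : stalkIdeal 𝒦 (τ (j₂ y)) = Ideal.span {f} := by rw [hf, Ideal.submodule_span_eq]
      have hy₂ : j₂ y ∉ ((((𝓔 ⊔ 𝒦₁).comap τ)).support : Set X₂) := fun h => hpZ ((hZiff' y).mpr h)
      refine ⟨f, hf', ?_⟩
      rw [stalkIdeal_strictTransformIdeal_of_not_mem τ _ _ hy₂, hf', Ideal.map_span, Set.image_singleton]
  -- (k-ii-loc)′ stalkwise, from clause (1)
  have hstalk : ∀ y : G', υ₂ y ∈ (V : Set G) →
      stalkIdeal ((strictTransformIdeal τ (𝓔 ⊔ 𝒦₁) 𝒦).comap j₂) y =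
        stalkIdeal (vanishingIdeal (⟨closure (closure (υ₂ ⁻¹' (K \ Z))), isClosed_closure⟩ : Closeds G')) y :=
    fun y hyV => stalkIdeal_eq_of_comap_ι_eq C1 (show y ∈ υ₂ ⁻¹ᵁ V from hyV)
  -- the old (k-iv) at the literal point `jG p`, fed by reducedness upstairs
  have HG : ∀ p : G, jG p ∈ ((𝓔 ⊔ 𝒦).support : Set X) → p ∈ (V : Set G) →
      IsReduced (X.presheaf.stalk (jG p) ⧸ (stalkIdeal (𝓔 ⊔ 𝒦) (jG p) ⊔
        Ideal.span {(X.presheaf.Γgerm (jG p)).hom ((σ ≫ q).appTop.hom ((Scheme.ΓSpecIso (.of O)).inv.hom ϖ))})) →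
      IsRegularLocalRing (X.presheaf.stalk (jG p) ⧸ stalkIdeal (𝓔 ⊔ 𝒦) (jG p)) := by
    intro p hp hpV hred
    haveI := hred
    refine hk_iv p hp (stalkIdeal_sup_vanishingIdeal_eq_inter_of_isReduced O k θ hθ (σ ≫ q) jG tG hsq ϖ hϖ 𝓔 𝒦 E (closure K) hE
      isClosed_closure p (by rw [he_i]) (stalkIdeal_eq_of_comap_ι_eq hk_ii hpV))
  obtain ⟨C4, C5⟩ := isEffectiveCartier_strictTransform_old_pair τ 𝓔 𝒦 𝒦₁ hXreg he_ii he_iii hk_i hk_v hk_vi hc3 hc4 hτ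
  refine ⟨C1, ?_, ?_, C4, C5⟩
  · -- (k-iii)′ flatness of the transported old pair, on the special stalks, through `τ♯`
    refine CILift.flat_subschemeι_comp_of_forall_stalk O ((τ ≫ σ) ≫ q) _ ϖ hϖ fun x' hx' hx's a ha => ?_
    obtain ⟨y, rfl⟩ : x' ∈ Set.range j₂ := by
      rw [range_eq_preimage_of_isPullback hsq₂, range_specMap_of_surjective_of_field θ hθ]; exact hx's
    have hyE : j₂ y ∈ ((strictTransformIdeal τ (𝓔 ⊔ 𝒦₁) 𝓔).support : Set X₂) := Scheme.IdealSheafData.support_antitone le_sup_left hx'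
    have hyK : j₂ y ∈ ((strictTransformIdeal τ (𝓔 ⊔ 𝒦₁) 𝒦).support : Set X₂) := Scheme.IdealSheafData.support_antitone le_sup_right hx'
    have hxE := hsuppStE _ hyE
    have hxK := hsuppStK _ hyK
    have hxEK : τ (j₂ y) ∈ ((𝓔 ⊔ 𝒦).support : Set X) := by
      rw [Scheme.IdealSheafData.support_sup]; exact ⟨hxE, hxK⟩
    obtain ⟨f, hf, hSt⟩ := hgenK y
    have hsum : stalkIdeal (strictTransformIdeal τ (𝓔 ⊔ 𝒦₁) 𝓔 ⊔ strictTransformIdeal τ (𝓔 ⊔ 𝒦₁) 𝒦) (j₂ y) =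
        stalkIdeal (strictTransformIdeal τ (𝓔 ⊔ 𝒦₁) 𝓔) (j₂ y) ⊔ (Ideal.span {f}).map (τ.stalkMap (j₂ y)).hom := by
      rw [stalkIdeal_sup, hSt, Ideal.map_span, Set.image_singleton]
    have hEKx : stalkIdeal (𝓔 ⊔ 𝒦) (τ (j₂ y)) = stalkIdeal 𝓔 (τ (j₂ y)) ⊔ Ideal.span {f} := by rw [stalkIdeal_sup, hf]
    rw [hsum] at ha ⊢
    rw [← hgermτ] at ha
    obtain ⟨b, hb⟩ := exists_sub_stalkMap_mem_of_iso_over' τ _ 𝓔 e𝓔 he𝓔 (j₂ y) hyE a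
    have h1 : (τ.stalkMap (j₂ y)).hom ((X.presheaf.Γgerm (τ (j₂ y))).hom ((σ ≫ q).appTop.hom ((Scheme.ΓSpecIso (.of O)).inv.hom ϖ)) * b) ∈
        stalkIdeal (strictTransformIdeal τ (𝓔 ⊔ 𝒦₁) 𝓔) (j₂ y) ⊔ (Ideal.span {f}).map (τ.stalkMap (j₂ y)).hom := by
      have h2 : (τ.stalkMap (j₂ y)).hom ((X.presheaf.Γgerm (τ (j₂ y))).hom ((σ ≫ q).appTop.hom ((Scheme.ΓSpecIso (.of O)).inv.hom ϖ)) * b) =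
          (τ.stalkMap (j₂ y)).hom ((X.presheaf.Γgerm (τ (j₂ y))).hom ((σ ≫ q).appTop.hom ((Scheme.ΓSpecIso (.of O)).inv.hom ϖ))) * a -
          (τ.stalkMap (j₂ y)).hom ((X.presheaf.Γgerm (τ (j₂ y))).hom ((σ ≫ q).appTop.hom ((Scheme.ΓSpecIso (.of O)).inv.hom ϖ))) *
            (a - (τ.stalkMap (j₂ y)).hom b) := by
        rw [map_mul]; ring
      rw [h2]
      exact Ideal.sub_mem _ ha (Ideal.mem_sup_left (Ideal.mul_mem_left _ _ hb))
    have h3 : (X.presheaf.Γgerm (τ (j₂ y))).hom ((σ ≫ q).appTop.hom ((Scheme.ΓSpecIso (.of O)).inv.hom ϖ)) * b ∈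
        stalkIdeal (𝓔 ⊔ 𝒦) (τ (j₂ y)) := by
      rw [hEKx]; exact (stalkMap_mem_sup_map_iff_of_iso_over' τ _ 𝓔 e𝓔 he𝓔 (j₂ y) hyE (Ideal.span {f}) _).mp h1
    haveI := hk_iii
    have h4 : b ∈ stalkIdeal (𝓔 ⊔ 𝒦) (τ (j₂ y)) :=
      mem_stalkIdeal_of_varpi_mul_mem_of_flat (σ ≫ q) (𝓔 ⊔ 𝒦) _ hxEK hϖ.ne_zero b h3
    rw [hEKx] at h4
    have h5 : (τ.stalkMap (j₂ y)).hom b ∈ stalkIdeal (strictTransformIdeal τ (𝓔 ⊔ 𝒦₁) 𝓔) (j₂ y) ⊔ (Ideal.span {f}).map (τ.stalkMap (j₂ y)).hom :=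
      (stalkMap_mem_sup_map_iff_of_iso_over' τ _ 𝓔 e𝓔 he𝓔 (j₂ y) hyE (Ideal.span {f}) b).mpr h4
    have h6 : a = (a - (τ.stalkMap (j₂ y)).hom b) + (τ.stalkMap (j₂ y)).hom b := by ring
    rw [h6]
    exact Ideal.add_mem _ (Ideal.mem_sup_left hb) h5
  · -- (k-iv)′ conditional regularity: the radical trace hypothesis descends to the old (k-iv), regularity ascends through `τ♯`
    intro hE' y hy hrad
    have hyE : j₂ y ∈ ((strictTransformIdeal τ (𝓔 ⊔ 𝒦₁) 𝓔).support : Set X₂) := Scheme.IdealSheafData.support_antitone le_sup_left hy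
    have hyK : j₂ y ∈ ((strictTransformIdeal τ (𝓔 ⊔ 𝒦₁) 𝒦).support : Set X₂) := Scheme.IdealSheafData.support_antitone le_sup_right hy
    have hxE := hsuppStE _ hyE
    have hxK := hsuppStK _ hyK
    have hxEK : τ (j₂ y) ∈ ((𝓔 ⊔ 𝒦).support : Set X) := by
      rw [Scheme.IdealSheafData.support_sup]; exact ⟨hxE, hxK⟩
    have hpE : υ₂ y ∈ E := (hEiff y).mpr hxE
    have hpV : υ₂ y ∈ (V : Set G) := hEV hpE
    obtain ⟨f, hf, hSt⟩ := hgenK y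
    have hsum : stalkIdeal (strictTransformIdeal τ (𝓔 ⊔ 𝒦₁) 𝓔 ⊔ strictTransformIdeal τ (𝓔 ⊔ 𝒦₁) 𝒦) (j₂ y) =
        stalkIdeal (strictTransformIdeal τ (𝓔 ⊔ 𝒦₁) 𝓔) (j₂ y) ⊔ (Ideal.span {f}).map (τ.stalkMap (j₂ y)).hom := by
      rw [stalkIdeal_sup, hSt, Ideal.map_span, Set.image_singleton]
    have hEKx : stalkIdeal (𝓔 ⊔ 𝒦) (τ (j₂ y)) = stalkIdeal 𝓔 (τ (j₂ y)) ⊔ Ideal.span {f} := by rw [stalkIdeal_sup, hf]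
    -- Step A: `R/((St 𝓔)_{y₂} + (τ♯ f) + (ϖ₂))` is reduced (trace hypothesis through `j₂♯`)
    set ψ := (j₂.stalkMap y).hom with hψ
    obtain ⟨J, hJ⟩ : ∃ J : Ideal (X₂.presheaf.stalk (j₂ y)),
        J = stalkIdeal (strictTransformIdeal τ (𝓔 ⊔ 𝒦₁) 𝓔) (j₂ y) ⊔ Ideal.span {(τ.stalkMap (j₂ y)).hom f} := ⟨_, rfl⟩
    have hJmap : J.map ψ = stalkIdeal (vanishingIdeal (⟨closure (υ₂ ⁻¹' (E \ Z)) ∩ closure (closure (υ₂ ⁻¹' (K \ Z))),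
        hE'.inter isClosed_closure⟩ : Closeds G')) y := by
      rw [← hrad, stalkIdeal_sup, ← ho1, ← hstalk y hpV, stalkIdeal_comap_eq_map_stalkMap, stalkIdeal_comap_eq_map_stalkMap, hSt,
        ← Ideal.map_sup, hJ]
    have hJrad : (J.map ψ).IsRadical := by rw [hJmap]; exact isRadical_stalkIdeal_vanishingIdeal _ y
    set φ : (X₂.presheaf.stalk (j₂ y) : Type) →+* (G'.presheaf.stalk y ⧸ J.map ψ) := (Ideal.Quotient.mk (J.map ψ)).comp ψ with hφ
    have hφsurj : Function.Surjective φ := Ideal.Quotient.mk_surjective.comp (j₂.stalkMap_surjective y)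
    have hkerφ : RingHom.ker φ = stalkIdeal (strictTransformIdeal τ (𝓔 ⊔ 𝒦₁) 𝓔) (j₂ y) ⊔
        (Ideal.span {f} ⊔ Ideal.span {(X.presheaf.Γgerm (τ (j₂ y))).hom ((σ ≫ q).appTop.hom ((Scheme.ΓSpecIso (.of O)).inv.hom ϖ))}).map
          (τ.stalkMap (j₂ y)).hom := by
      have h1 : RingHom.ker φ = Ideal.comap ψ (J.map ψ) := by
        rw [hφ, ← RingHom.comap_ker, Ideal.mk_ker]
      have hkerψ : RingHom.ker ψ = Ideal.span {(τ.stalkMap (j₂ y)).hom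
          ((X.presheaf.Γgerm (τ (j₂ y))).hom ((σ ≫ q).appTop.hom ((Scheme.ΓSpecIso (.of O)).inv.hom ϖ)))} := by
        refine le_antisymm (hker₂ y) ?_
        rw [Ideal.span_singleton_le_iff_mem, RingHom.mem_ker]
        exact hϖ₂0 y
      rw [h1, Ideal.comap_map_of_surjective _ (j₂.stalkMap_surjective y), ← RingHom.ker_eq_comap_bot, hkerψ, hJ, Ideal.map_sup, Ideal.map_span,
        Ideal.map_span, Set.image_singleton, Set.image_singleton, sup_assoc]
    haveI : IsReduced (G'.presheaf.stalk y ⧸ J.map ψ) := (Ideal.isRadical_iff_quotient_reduced _).mp hJrad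
    have e₁ := RingHom.quotientKerEquivOfSurjective hφsurj
    haveI : IsReduced (X₂.presheaf.stalk (j₂ y) ⧸ RingHom.ker φ) := isReduced_of_injective e₁.toRingHom e₁.injective
    haveI hredR : IsReduced (X₂.presheaf.stalk (j₂ y) ⧸ (stalkIdeal (strictTransformIdeal τ (𝓔 ⊔ 𝒦₁) 𝓔) (j₂ y) ⊔
        (Ideal.span {f} ⊔ Ideal.span {(X.presheaf.Γgerm (τ (j₂ y))).hom ((σ ≫ q).appTop.hom ((Scheme.ΓSpecIso (.of O)).inv.hom ϖ))}).map
          (τ.stalkMap (j₂ y)).hom)) :=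
      isReduced_of_injective (Ideal.quotEquivOfEq hkerφ.symm).toRingHom (Ideal.quotEquivOfEq hkerφ.symm).injective
    -- Step B: down through `τ♯`: `𝒪_{X,x}/((𝓔 + 𝒦)_x + (ϖ))` is reduced
    obtain ⟨Θ₂, -⟩ := exists_ringEquiv_quotient_of_iso_over' τ _ 𝓔 e𝓔 he𝓔 (j₂ y) hyE
      (Ideal.span {f} ⊔ Ideal.span {(X.presheaf.Γgerm (τ (j₂ y))).hom ((σ ≫ q).appTop.hom ((Scheme.ΓSpecIso (.of O)).inv.hom ϖ))})
    have hredA : IsReduced (X.presheaf.stalk (τ (j₂ y)) ⧸ (stalkIdeal (𝓔 ⊔ 𝒦) (τ (j₂ y)) ⊔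
        Ideal.span {(X.presheaf.Γgerm (τ (j₂ y))).hom ((σ ≫ q).appTop.hom ((Scheme.ΓSpecIso (.of O)).inv.hom ϖ))})) := by
      rw [hEKx, sup_assoc]
      exact isReduced_of_injective Θ₂.toRingHom Θ₂.injective
    -- Step C: the old (k-iv) at `p = υ₂ y`
    have hG := HG (υ₂ y)
    rw [← hpt y] at hG
    haveI hreg := hG hxEK hpV hredA
    -- Step D: up through `τ♯`
    obtain ⟨Θ₁, -⟩ := exists_ringEquiv_quotient_of_iso_over' τ _ 𝓔 e𝓔 he𝓔 (j₂ y) hyE (Ideal.span {f})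
    rw [← hEKx, ← hsum] at Θ₁
    exact IsRegularLocalRing.of_ringEquiv Θ₁

end Summit.ResolutionOfSingularities.ResolutionOfSingularities.Cruxes.EquisingularLiftNat.Sections

end
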